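/-
Copyright (c) 2026. All rights reserved.
Released under Apache 2.0 license as described in the file LICENSE.
-/
import Literature.AlgebraicGeometry.ComplexMultiplication.HyperellipticJacobianQuadraticReflexSeparation
import HarnessLib

/-!
# `ζ_5 ∉ F_{60} = K*(Φ_{60})`: `X_5, X_{10}, X_{15}, … ⟂ Y_{60}` — every odd-level factor `X_d` is orthogonal to `Y_{60}`

Layer `Literature/AlgebraicGeometry/ComplexMultiplication`, namespace `…ComplexMultiplication.HyperellipticJacobian`; the sequel of
`HyperellipticJacobianCrossLevelOrthogonality` (F12: `X_d ⟂ Y_{60}` for odd `d ∉ {3, 5}` by degrees), `HyperellipticJacobianQuadraticReflexSeparation`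
(F17: `d = 3`) and `HyperellipticJacobianReflexFields` ∕ `HyperellipticJacobianLevelDivisibleByFour` (F10 ∕ F8: `K*(Φ_{60}) = ℚ(x r)`,
`r = ζ + ζ¹¹ + ζ¹⁹ + ζ²⁹`, `r⁴ + 15r² + 45 = 0`, degree `4`).  THEOREMS ONLY (no definition, no named fact, no `sorry`, no instance).

## The print

A. Gallese, H. Goodson, D. Lombardo, arXiv:2405.20394 [GalleseGoodsonLombardo2024] (held `paper:arxiv-2405.20394`, p0012, p0014): THM. 3.0, last
statement («all `X_d` with odd `d` and all `Y_d` are pairwise non-isogenous»), and §3.4 («the CM field of `Y_{60}` is the splitting field of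
`x⁴ + 15x² + 45`», a degree-`4` subfield `F_{60}` of `ℚ(ζ_{60})`).  The only odd level whose reflex degree equals `[F_{60} : ℚ] = 4` is `d = 5`
(`φ(5) = 4`); there the two fields `ℚ(ζ_5)` and `F_{60}` are distinguished by the automorphism `ζ_{60} ↦ −ζ_{60}` of `ℚ(ζ_{60})`, which fixes
`ζ_5 = ζ_{60}^{12}` and sends `r ↦ −r`.

## What is proved

* **`not_isPrimitiveRoot_five_of_mem_traceField_sixty`**: `K*(Φ_{60}) ⊂ ℂ` contains no primitive `5`-th root of unity.  (If `y` were one: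
  `ℚ(y) = K*(Φ_{60})` by degrees; `y = x(η)`, `η = ζ^k` with `12 ∣ k`; `r ∈ ℚ(η)` is fixed by `σ : ζ ↦ −ζ` (Mathlib `fromZetaAut`), but
  `σ r = −r`, so `r = 0`, contradicting `r⁴ + 15r² + 45 = 0`.)
* **`orthogonal_odd_sixty_of_five_dvd`**, **`orthogonal_twiceOdd_sixty_of_five_dvd`** (`X_d, X_{2n} ⟂ Y_{60}` whenever `5 ∣ d, n` — so
  `X_5, X_{10}, X_{15} ⟂ Y_{60}`), and the packaging **`orthogonal_odd_sixty'`**: `X_d ⟂ Y_{60}` for EVERY odd `d ≥ 3` (F12 + F17 + §1) —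
  `Hom = 0` both ways and non-isogenous, for all realisations.

## Honest column ∕ NOT here

The curve; `Y_d` vs `Y_{d′}` with `φ(d) = φ(d′)`, `d ≡ d′ (mod 8)` (conductor theory); `J_{60}`.  `HC_CM` is not touched.

## References

* [GalleseGoodsonLombardo2024] arXiv:2405.20394 — §3 Thm. 3.0 (last statement), §3.4 (`F_{60}`), §3.5 Lemma 14.
* [Shimura1998] G. Shimura — §8.3 Prop. 28, §8.4 Example (1).
* [MilneCM2006] J. S. Milne — Ch. I §1 Prop. 1.18 (c), §3 Prop. 3.13.

## Provenance

Cell `pub-hodgecm2` (COR-CM), KEPT Literature lane `lit-deligne-3` gen 51 (claim GGL24-LEVEL-SIXTY-SEPARATION; count-neutral, own lane).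
-/

noncomputable section

open CategoryTheory CategoryTheory.Limits NumberField Module

namespace Literature.AlgebraicGeometry.ComplexMultiplication

open Literature.AlgebraicGeometry.Motives
open Literature.AlgebraicGeometry.HodgeTheory (complexBetti)
open Literature.NumberTheory.ComplexMultiplication

namespace HyperellipticJacobian

open Literature.AlgebraicGeometry.Pohlmann1968 Literature.AlgebraicGeometry.Pohlmann1968.Cyclotomic

section Sixty

variable {K : Type} [Field K] [NumberField K]

/-- **`ζ_5 ∉ F_{60} = K*(Φ_{60})`**: the reflex field of the lower-half type at level `60`, read in `ℂ`, contains no primitive `5`-th root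
of unity — although `[ℚ(ζ_5) : ℚ] = [F_{60} : ℚ] = 4`.  (The automorphism `ζ ↦ −ζ` of `ℚ(ζ_{60})` fixes `ζ^{12}` and negates
`r = ζ + ζ¹¹ + ζ¹⁹ + ζ²⁹`, the generator of `F_{60}`, F10 ∕ F8.)
[cite: GalleseGoodsonLombardo2024, §3.4 (`F_{60}`) and §3 Thm. 3.0 (last statement)] [cite: Shimura1998, §8.3 Prop. 28 and §8.4 Example (1)] -/
theorem not_isPrimitiveRoot_five_of_mem_traceField_sixty [IsCyclotomicExtension {60} ℚ K] (Φ : CMType K)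
    (hΦ : ∀ σ : K →+* ℂ, σ ∈ Φ.1 ↔ 2 * (expOf 60 K σ).val < 60) {y : ℂ} (hy : y ∈ traceField Φ) :
    ¬ IsPrimitiveRoot y 5 := by
  classical
  haveI : NeZero (60 : ℕ) := ⟨by norm_num⟩
  intro hy5
  obtain ⟨x⟩ := (inferInstance : Nonempty (K →+* ℂ))
  obtain ⟨htr, hpoly, hfr, -⟩ := traceField_sixty Φ hΦ x
  set ζ := zetaOf 60 K with hζdef
  have hζ : IsPrimitiveRoot ζ 60 := IsCyclotomicExtension.zeta_spec 60 ℚ K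
  set r : K := ζ + ζ ^ 11 + ζ ^ 19 + ζ ^ 29 with hrdef
  -- Step 1: `ℚ(y) = K*(Φ)` by degrees
  haveI : FiniteDimensional ℚ (traceField Φ) := Module.finite_of_finrank_pos (finrank_traceField_pos Φ)
  have hint : IsIntegral ℚ y := IsIntegral.of_pow (by norm_num : 0 < 5) (by rw [hy5.pow_eq_one]; exact isIntegral_one)
  have hdeg : finrank ℚ (IntermediateField.adjoin ℚ {y}) = 4 := by
    rw [IntermediateField.adjoin.finrank hint, ← Polynomial.cyclotomic_eq_minpoly_rat hy5 (by norm_num),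
      Polynomial.natDegree_cyclotomic]
    decide +kernel
  have heq : IntermediateField.adjoin ℚ {y} = traceField Φ :=
    IntermediateField.eq_of_le_of_finrank_eq (IntermediateField.adjoin_simple_le_iff.2 hy) (by rw [hdeg, hfr])
  -- Step 2: `y = x η`, `η` a primitive `5`-th root of unity of `K`, `η = ζ^k` with `12 ∣ k`
  have hyr : y ∈ x.toRatAlgHom.fieldRange := by
    have hle : traceField Φ ≤ x.toRatAlgHom.fieldRange := by
      rw [htr]
      exact IntermediateField.adjoin_simple_le_iff.2 ⟨r, rfl⟩
    exact hle hy
  obtain ⟨η, hη⟩ := AlgHom.mem_fieldRange.1 hyr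
  have hηy : x η = y := hη
  have hη5 : IsPrimitiveRoot η 5 := by
    rw [← hηy] at hy5
    exact hy5.of_map_of_injective x.injective
  obtain ⟨k, -, hk⟩ := hζ.eq_pow_of_pow_eq_one (show η ^ 60 = 1 by
    rw [show (60 : ℕ) = 5 * 12 by norm_num, pow_mul, hη5.pow_eq_one, one_pow])
  have h12 : 12 ∣ k := by
    have h : ζ ^ (k * 5) = 1 := by rw [pow_mul, hk, hη5.pow_eq_one]
    rw [hζ.pow_eq_one_iff_dvd] at h
    have h' : 12 * 5 ∣ k * 5 := by simpa [mul_comm] using h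
    exact Nat.dvd_of_mul_dvd_mul_right (by norm_num) h'
  -- Step 3: `r ∈ ℚ(η)`
  have hr : r ∈ IntermediateField.adjoin ℚ {η} := by
    have hxr : x r ∈ IntermediateField.adjoin ℚ {y} := by
      rw [heq, htr]; exact IntermediateField.mem_adjoin_simple_self ℚ _
    rw [← hηy, show ({x η} : Set ℂ) = x.toRatAlgHom '' {η} by simp, ← IntermediateField.adjoin_map,
      IntermediateField.mem_map] at hxr
    obtain ⟨z, hz, hzr⟩ := hxr
    have : z = r := x.injective hzr
    rwa [this] at hz
  -- Step 4: the automorphism `σ : ζ ↦ −ζ`; it fixes `η` and hence `r`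
  have h30 : ζ ^ 30 = -1 := (hζ.pow (by norm_num) (show 60 = 30 * 2 by norm_num)).eq_neg_one_of_two_right
  have hneg : IsPrimitiveRoot (-ζ) 60 := by
    have h : -ζ = ζ ^ 31 := by rw [pow_succ, h30]; ring
    rw [h]
    exact hζ.pow_of_coprime 31 (by decide)
  have hirr : Irreducible (Polynomial.cyclotomic 60 ℚ) := Polynomial.cyclotomic.irreducible_rat (by norm_num)
  let σ : K ≃ₐ[ℚ] K := IsCyclotomicExtension.fromZetaAut hneg hirr
  have hσζ : σ ζ = -ζ := IsCyclotomicExtension.fromZetaAut_spec hneg hirr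
  have hση : σ η = η := by
    obtain ⟨j, rfl⟩ := h12
    rw [← hk, map_pow, hσζ, Even.neg_pow ⟨6 * j, by ring⟩]
  have hσr : σ r = r := by
    have hle : IntermediateField.adjoin ℚ {η} ≤ IntermediateField.fixedField (MulAction.stabilizer (K ≃ₐ[ℚ] K) η) := by
      rw [IntermediateField.adjoin_simple_le_iff, IntermediateField.mem_fixedField_iff]
      intro f hf
      simpa [MulAction.mem_stabilizer_iff, AlgEquiv.smul_def] using hf
    have hmem := hle hr
    rw [IntermediateField.mem_fixedField_iff] at hmem
    exact hmem σ (by rw [MulAction.mem_stabilizer_iff, AlgEquiv.smul_def, hση])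
  -- Step 5: but `σ r = −r`, so `r = 0`, contradicting `r⁴ + 15 r² + 45 = 0`
  have hσr' : σ r = -r := by
    simp only [hrdef, map_add, map_pow, hσζ]
    ring
  have hr0 : r = 0 := by
    have h : (2 : K) * r = 0 := by linear_combination (-1 : K) * (hσr'.symm.trans hσr)
    simpa using h
  have hx0 : x r = 0 := by rw [hr0, map_zero]
  rw [hx0] at hpoly
  norm_num at hpoly

variable {d : ℕ} [NeZero d] {Φ : CMType K}
  {A : AbelianVariety ℂ} {ι : 𝓞 K →+* End A} {θ : K →+* Module.End ℂ (complexBetti A.X 1)}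
  {K' : Type} [Field K'] [NumberField K'] {Φ' : CMType K'}
  {A' : AbelianVariety ℂ} {ι' : 𝓞 K' →+* End A'} {θ' : K' →+* Module.End ℂ (complexBetti A'.X 1)}
  {n : ℕ} [NeZero (2 * n)] {L : Type} [Field L] [NumberField L] [IsCyclotomicExtension {2 * n} ℚ L] {Ψ : CMType L}
  {B : AbelianVariety ℂ} {ιB : 𝓞 L →+* End B} {θB : L →+* Module.End ℂ (complexBetti B.X 1)}

/-- **`X_d ⟂ Y_{60}` for odd `d` with `5 ∣ d`** — in particular **`X_5 ⟂ Y_{60}`** (`ζ_5 ∈ K*(Φ_d) = x(ℚ(ζ_d))`, `ζ_5 ∉ F_{60}`): `Hom = 0`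
both ways and non-isogenous, for all realisations. [cite: GalleseGoodsonLombardo2024, §3 Thm. 3.0 (last statement) and §3.4]
[cite: MilneCM2006, Ch. I §1 Prop. 1.18 (c) and §3 Prop. 3.13] -/
theorem orthogonal_odd_sixty_of_five_dvd [IsCyclotomicExtension {d} ℚ K] [IsCyclotomicExtension {60} ℚ K'] (hd : Odd d) (h5 : 5 ∣ d)
    (hΦ : ∀ σ : K →+* ℂ, σ ∈ Φ.1 ↔ 2 * (expOf d K σ).val < d) (hA : IsCMTypeRealisation Φ A ι θ)
    (hΦ' : ∀ σ : K' →+* ℂ, σ ∈ Φ'.1 ↔ 2 * (expOf 60 K' σ).val < 60) (hA' : IsCMTypeRealisation Φ' A' ι' θ') :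
    (∀ u : A ⟶ A', u = 0) ∧ (∀ v : A' ⟶ A, v = 0) ∧
      ¬ AbelianVariety.IsIsogenous A A' ∧ ¬ AbelianVariety.IsIsogenous A' A := by
  refine hA.orthogonal_of_isPrimitiveRoot hA' (n := 5) ?_ fun _ hy => not_isPrimitiveRoot_five_of_mem_traceField_sixty Φ' hΦ' hy
  obtain ⟨y, hy, hyd⟩ := exists_isPrimitiveRoot_mem_traceField_odd hd Φ hΦ
  have hd0 : d / 5 ≠ 0 := by
    obtain ⟨e, rfl⟩ := h5
    have : e ≠ 0 := by rintro rfl; exact NeZero.ne (5 * 0) rfl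
    simpa using this
  refine ⟨y ^ (d / 5), pow_mem hy _, ?_⟩
  have h := hyd.pow_of_dvd hd0 (Nat.div_dvd_of_dvd h5)
  rwa [Nat.div_div_self h5 (NeZero.ne d)] at h

/-- **`X_{2n} ⟂ Y_{60}` for odd `n ≥ 3` with `5 ∣ n`** — in particular **`X_{10} ⟂ Y_{60}`**.
[cite: GalleseGoodsonLombardo2024, §3 Thm. 3.0 (4) and (last statement), §3.4] [cite: MilneCM2006, Ch. I §1 Prop. 1.18 (c) and §3 Prop. 3.13] -/
theorem orthogonal_twiceOdd_sixty_of_five_dvd [IsCyclotomicExtension {60} ℚ K'] (hn : Odd n) (h3n : 3 ≤ n) (h5 : 5 ∣ n)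
    (hΨ : ∀ σ : L →+* ℂ, σ ∈ Ψ.1 ↔ 2 * (expOf (2 * n) L σ).val < 2 * n) (hB : IsCMTypeRealisation Ψ B ιB θB)
    (hΦ' : ∀ σ : K' →+* ℂ, σ ∈ Φ'.1 ↔ 2 * (expOf 60 K' σ).val < 60) (hA' : IsCMTypeRealisation Φ' A' ι' θ') :
    (∀ u : B ⟶ A', u = 0) ∧ (∀ v : A' ⟶ B, v = 0) ∧
      ¬ AbelianVariety.IsIsogenous B A' ∧ ¬ AbelianVariety.IsIsogenous A' B := by
  haveI : NeZero n := ⟨by omega⟩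
  refine hB.orthogonal_of_isPrimitiveRoot hA' (n := 5) ?_ fun _ hy => not_isPrimitiveRoot_five_of_mem_traceField_sixty Φ' hΦ' hy
  obtain ⟨y, hy, hyn⟩ := exists_isPrimitiveRoot_mem_traceField_twiceOdd hn h3n Ψ hΨ
  have hn0 : n / 5 ≠ 0 := by
    intro h
    have := Nat.lt_of_div_eq_zero (by norm_num) h
    omega
  refine ⟨y ^ (n / 5), pow_mem hy _, ?_⟩
  have h := hyn.pow_of_dvd hn0 (Nat.div_dvd_of_dvd h5)
  rwa [Nat.div_div_self h5 (by omega)] at h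

/-- **THM. 3.0, last statement: `X_d ⟂ Y_{60}` for EVERY odd `d ≥ 3`** (F12 for `d ∉ {3, 5}`-type levels by degrees ∕ roots of unity,
F17 for `φ(d) ≠ 4`, §1 for `5 ∣ d`): `Hom = 0` both ways and non-isogenous, for all realisations.
[cite: GalleseGoodsonLombardo2024, §3 Thm. 3.0 (last statement)] [cite: MilneCM2006, Ch. I §3 Prop. 3.13] -/
theorem orthogonal_odd_sixty' [IsCyclotomicExtension {d} ℚ K] [IsCyclotomicExtension {60} ℚ K'] (hd : Odd d) (h3 : 3 ≤ d)
    (hΦ : ∀ σ : K →+* ℂ, σ ∈ Φ.1 ↔ 2 * (expOf d K σ).val < d) (hA : IsCMTypeRealisation Φ A ι θ)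
    (hΦ' : ∀ σ : K' →+* ℂ, σ ∈ Φ'.1 ↔ 2 * (expOf 60 K' σ).val < 60) (hA' : IsCMTypeRealisation Φ' A' ι' θ') :
    (∀ u : A ⟶ A', u = 0) ∧ (∀ v : A' ⟶ A, v = 0) ∧
      ¬ AbelianVariety.IsIsogenous A A' ∧ ¬ AbelianVariety.IsIsogenous A' A := by
  by_cases h5 : 5 ∣ d
  · exact orthogonal_odd_sixty_of_five_dvd hd h5 hΦ hA hΦ' hA'
  by_cases hd3 : d = 3
  · subst hd3
    exact orthogonal_odd_sixty_of_totient_ne_four hd (by decide +kernel) hΦ hA hΦ' hA'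
  · exact orthogonal_odd_sixty hd h3 hd3 (fun h => by subst h; exact absurd dvd_rfl h5) hΦ hA hΦ' hA'

end Sixty

end HyperellipticJacobian

end Literature.AlgebraicGeometry.ComplexMultiplication

end
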